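import Summits.BirchSwinnertonDyer.Rank1Residual.Additive.AdditiveTamagawaWitness
import Summits.BirchSwinnertonDyer.Rank1Residual.Additive.LocalPointBaseChange
import Summits.BirchSwinnertonDyer.Rank1Residual.Additive.UnramifiedBaseChange
import HarnessLib

/-!
# The additive Tamagawa witness SURVIVES an unramified Galois base change: at a place `w ∣ v` of
# `M ⊇ K` with `e(v) = 1`, `v ∤ p` additive for `E` and `p ∣ c_v(E/K)`, an unramified class of
# `H¹(M_w, E[p])` outside the local Kummer image of `E_M`
# (cell `b2b-bsdres`, team n1011, seat p06 GEN 4; OWNERS row T-E3g-ADD, FILE F — the layer form)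

HONEST FRAMING (cell `b2b-bsdres`, run/shared/lean/b2b/bsd-rank1-residual/, verbatim in every
file): the goal of the cell is to DELETE the COMBINATION-SHAPED residual classes of the
Birch–Swinnerton-Dyer formula for ALL analytic-rank `≤ 1` elliptic curves over `ℚ` — "full BSD
formula for every rank `≤ 1` curve in class `C`" assembled STRICTLY from published theorems — so
that the rank-`≤ 1` remainder becomes exactly the CONSTRUCTION-SHAPED classes, which are TYPED
(missing-input `Prop`s), NOT attempted. This is not "finishing BSD". Team n1011 (N10/N11: X4 ∧
`p = 3`): research routes on CONSTRUCTION-SHAPED classes; nothing is booked by this file.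
THEOREMS ONLY: no definition, no named fact, nothing asserted.

## What (row T-E3g-ADD; consumer: T-E3g-BUDn at the additive places of the layers `ℚ_n`)

ROUTE-2 II.17.3 D-n.3 (add) "ADD-loc over `K_{n,w}`": the level-`n` Route-G budget door counts
relaxed-Kummer classes over the layer `ℚ_n` and needs, at each place `w ∣ ℓ` of `ℚ_n` above an
additive Tamagawa prime `ℓ ≠ p` of `E/ℚ`, the witness
`∃ u ∈ H¹_ur((ℚ_n)_w, E[p]), u ∉ 𝓚_w` for `E_{ℚ_n}`. THIS FILE proves it for ANY finite Galois
extension `M/K` of number fields and `w ∣ v` with `v` UNRAMIFIED in `M` (`e(v) = 1` — automatic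
for `ℓ ≠ p` in the cyclotomic `ℤ_p`-tower), from the data OVER `K` only (`v ∤ p`, `p` odd, `E`
additive at `v`, `p ∣ c_v(E/K)`):

* additive reduction persists at `w` (additive-p2's
  `Additive.hasAdditiveReductionAt_baseChange_of_ramificationIdxIn_eq_one`, Silverman *AEC*
  VII.5.4 via the unramified Artin formalism — a kernel theorem, no Kodaira-symbol fact);
* a nonzero `p`-torsion point of `E(K_v)` (`TamagawaLocalTorsion`, from `p ∣ c_v`) is carried to a
  nonzero `p`-torsion point of `E_M(M_w)` (`LocalPointBaseChange`, along `K_v → M_w`);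
* the Tamagawa-free witness `…_of_hasAdditiveReductionAt_of_point` of `AdditiveTamagawaWitness`
  at `(E_M, w)`.

So NO persistence of the Tamagawa number `c_w` under base change is used (the tree records only
`c_w ∈ {1, 3}` above a IV / IV* place, `KodairaSymbolUnramifiedBaseChange`); the Tamagawa
hypothesis enters once, over `K`.

References: R. Greenberg, LNM 1716 (1999) §2 p. 74, §5 (406D1, the level-1 door)
[GreenbergLNM1716]; J. H. Silverman, *AEC* Prop. VII.5.4, Thm. VII.6.1 [SilvermanAEC2009];
ROUTE-2 II.17.3 (cells/n1011/).
-/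

set_option autoImplicit false

noncomputable section

open scoped Classical

open NumberField IsDedekindDomain Field
open Literature.NumberTheory.EllipticCurves Literature.NumberTheory.GaloisRepresentations
  Literature.NumberTheory.GaloisRepresentations.IsNonarchimedeanLocalField
open Summit.BirchSwinnertonDyer.Rank1Residual.X11b

namespace Summit.BirchSwinnertonDyer.Rank1Residual.Additive

universe u

variable {K : Type u} [Field K] [NumberField K] (W : WeierstrassCurve K) [W.IsElliptic] (p : ℕ)
  [hp : Fact p.Prime] (M : Type u) [Field M] [NumberField M] [Algebra K M] [FiniteDimensional K M]
  [IsGalois K M] {v : HeightOneSpectrum (𝓞 K)} {w : HeightOneSpectrum (𝓞 M)}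

/-- **The additive Tamagawa witness over an unramified Galois extension, from a point over `K`.**
`M/K` finite Galois, `w ∣ v`, `e(v) = 1`, `v ∤ p`, `p` odd, `E` additive at `v`, and `T ∈ E(K_v)`
nonzero with `p • T = 0`: then `∃ u ∈ H¹_ur(M_w, E[p]), u ∉ 𝓚_w` for `E_M` at `w`.
[cite: SilvermanAEC2009, Prop. VII.5.4 and Thm. VII.6.1] [cite: GreenbergLNM1716, §2, p. 74] -/
theorem exists_mem_unramifiedSubgroup_not_mem_kummerLocalConditionAt_baseChange_of_point
    (hw : w.asIdeal.under (𝓞 K) = v.asIdeal) (he : v.asIdeal.ramificationIdxIn (𝓞 M) = 1)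
    (hpv : ((p : ℕ) : 𝓞 K) ∉ v.asIdeal) (hp2 : p ≠ 2) (hadd : W.HasAdditiveReductionAt v)
    {T : (W.baseChange (v.adicCompletion K)).toAffine.Point} (hT : T ≠ 0) (hpT : (p : ℤ) • T = 0) :
    ∃ u ∈ DiscreteGaloisModule.unramifiedSubgroup
        (GaloisRep.restrictField (w.adicCompletion M)
          ((W.baseChange M).torsionGaloisModule (p : ℤ))) 1,
      u ∉ (W.baseChange M).kummerLocalConditionAt (p : ℤ) (w.adicCompletion M) := by
  haveI : (W.baseChange M).IsElliptic := by
    dsimp only [WeierstrassCurve.baseChange]; infer_instance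
  haveI : w.asIdeal.LiesOver v.asIdeal := ⟨hw.symm⟩
  -- `w ∤ p` from `v ∤ p`
  have hpw : ((p : ℕ) : 𝓞 M) ∉ w.asIdeal := fun h ↦ hpv (by
    rw [← hw, Ideal.mem_under, map_natCast]; exact h)
  have haddw : (W.baseChange M).HasAdditiveReductionAt w :=
    hasAdditiveReductionAt_baseChange_of_ramificationIdxIn_eq_one W M hw he hadd
  obtain ⟨T', hT', hpT'⟩ :=
    exists_point_ne_zero_zsmul_eq_zero_baseChange_adicCompletion_of_liesOver W M v w hT hpT
  exact exists_mem_unramifiedSubgroup_not_mem_kummerLocalConditionAt_of_hasAdditiveReductionAt_of_point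
    (W.baseChange M) p w hpw hp2 haddw hT' hpT'

/-- **The additive Tamagawa witness over an unramified Galois extension** — the level-`n` form of
`AdditiveTamagawaWitness` (ROUTE-2 II.17.3 D-n.3 (add)): for `M/K` finite Galois, `w ∣ v` with
`e(v) = 1`, `v ∤ p`, `p` odd, `E` additive at `v` and `p ∣ c_v(E/K)`:
`∃ u ∈ H¹_ur(M_w, E[p]), u ∉ 𝓚_w` for `E_M` at `w` — the `hwit` binder of the K-general level-`0`
socket (`exists_finset_layerZero_of_tamagawaWitnesses`) at `K := M = ℚ_n`, `W := E_M`. The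
Tamagawa hypothesis is used over `K` only; no persistence of `c_w` is needed.
[cite: SilvermanAEC2009, Prop. VII.5.4 and Thm. VII.6.1] [cite: GreenbergLNM1716, §2 p. 74 and §5 (406D1)] -/
theorem exists_mem_unramifiedSubgroup_not_mem_kummerLocalConditionAt_baseChange_of_dvd_localTamagawaNumber
    (hw : w.asIdeal.under (𝓞 K) = v.asIdeal) (he : v.asIdeal.ramificationIdxIn (𝓞 M) = 1)
    (hpv : ((p : ℕ) : 𝓞 K) ∉ v.asIdeal) (hp2 : p ≠ 2) (hadd : W.HasAdditiveReductionAt v)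
    (hc : p ∣ (W.baseChange (v.adicCompletion K)).localTamagawaNumber (v.adicCompletionIntegers K)) :
    ∃ u ∈ DiscreteGaloisModule.unramifiedSubgroup
        (GaloisRep.restrictField (w.adicCompletion M)
          ((W.baseChange M).torsionGaloisModule (p : ℤ))) 1,
      u ∉ (W.baseChange M).kummerLocalConditionAt (p : ℤ) (w.adicCompletion M) := by
  obtain ⟨T, hT, hpT⟩ :=
    exists_point_ne_zero_zsmul_eq_zero_of_dvd_localTamagawaNumber W p v hpv hc
  exact exists_mem_unramifiedSubgroup_not_mem_kummerLocalConditionAt_baseChange_of_point W p M hw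
    he hpv hp2 hadd hT hpT

end Summit.BirchSwinnertonDyer.Rank1Residual.Additive

end
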